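import Summits.ResolutionOfSingularities.ResolutionOfSingularities.Theses.HilbertSamuelElimination
import Literature.AlgebraicGeometry.Resolution.HilbertSamuelLocal

/-!
# `SigmaMaxModifications` — negative lemmas I: junk witnesses, (ME2), load-bearing hypotheses

Support (negative) lemmas for crux `stmt-ResolutionOfSingularities-18506`
(`Summit.ResolutionOfSingularities.ResolutionOfSingularities.Theses.HilbertSamuelElimination.SigmaMaxModifications`:
CJS LNM 2270 Def. 6.15 in modification form — for every reduced separated finite-type `X / k`,
`char k = p`, not regular, and every `N ≥ dim X`, a proper `π : X' → X` with `X'` reduced of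
dimension `≤ N`, an isomorphism over every open inside `X ∖ X_max` (ME1) with dense preimage of
`X ∖ X_max`, `H^N_{X'}(x') ≤ H^N_X(π x')` pointwise, and no maximal value of `H^N_X` a value of
`H^N_{X'}` (ME2)), filed by the standing disprover (cdisprove cycle 1; work file
`Cruxes/SigmaMaxModifications/Disproof.lean`). This file declares NO definition and NO
declaration concludes the route decl positively. The crux's inline
`H Y y = hilbertSamuelFun 𝒪_{Y,y} (N - minimalPrimesCodim 𝒪_{Y,y})` IS the tree's
`Scheme.hsFun Y N y`, its value set is `Scheme.hsValues`, its Hilbert–Samuel locus is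
`Scheme.hsMaxLocus` — all by `rfl` (`sigmaMaxModifications_iff_hsFun`), and the lemmas are stated
over those.

* `sigmaMaxModifications_iff_hsFun` — the definitional bridge (`Iff.rfl`).
* JUNK WITNESSES. `emptyWitness_clauses` / `withoutME1_trivial`: the EMPTY scheme satisfies
  every clause except (ME1), for every `X` and `N`, so the crux with (ME1) deleted is trivially
  true; `not_isIso_emptyTo_restrict`: (ME1) fails for `∅` over any non-empty open.
  `identityWitness_clauses` / `withoutME2_of_dense`: the IDENTITY satisfies every clause except
  (ME2) given `Dense (X_max)ᶜ`; `ME2_self_iff`: (ME2) for the identity holds iff `X_max = ∅`.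
  So the existence content of the crux is exactly (ME1) + (ME2).
* (ME2). `ME2_iff_forall_lt`: given monotonicity, (ME2) ⟺ strict drop `H_{X'}(x') < H_X(π x')`
  over `X_max` (CJS, remark after Def. 6.15); `hsFun_eq_of_isIso_restrict`: over an (ME1)-open
  the function is unchanged.
* LOAD-BEARING HYPOTHESES, through (ME1): `isReduced_opens_of_isIso_restrict` (so `IsReduced X`
  cannot be dropped: a non-reduced open inside `X ∖ X_max` has no reduced `X'` over it),
  `topologicalKrullDim_opens_le_of_isIso_restrict` (so `dim X ≤ N` cannot be dropped: at `N = 0`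
  a curve has a one-dimensional open inside `X ∖ X_max`); `hsMaxLocus_eq_univ_of_isRegular` /
  `exists_witness_of_isRegular` / `withoutNotIsRegular_of_sigmaMaxModifications`
  (`¬ IsRegular X` is REDUNDANT: for regular `X` the empty scheme is a witness).
* Level dependence of `X_max`, level transfer and the printed Spivakovsky–Hauser cycle: companion
  file `Levels.lean`.

## Sources
* V. Cossart, U. Jannsen, S. Saito, *Desingularization: Invariants and Strategy*, LNM 2270
  (2020): Def. 2.28, Rem. 2.29, Lemma 2.31, Rem. 2.32, Def. 2.35, Def. 6.15 (pp. 33–37, 84–86).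
* The Stacks Project, Tag 02IZ (`dim 𝒪_{X,x}` as a coheight).
-/

noncomputable section

-- single-problem summit: the doubled namespace component `ResolutionOfSingularities` is forced
set_option linter.dupNamespace false

open CategoryTheory AlgebraicGeometry TopologicalSpace Topology
open Literature.RingTheory.HilbertSamuel Literature.AlgebraicGeometry.Resolution

namespace Summit.ResolutionOfSingularities.ResolutionOfSingularities.Theorems.SigmaMaxModifications.Negative

open Summit.ResolutionOfSingularities.ResolutionOfSingularities.Theses.HilbertSamuelElimination
  (SigmaMaxModifications)

/-! ## The definitional bridge -/

/-- **The crux over the tree's Hilbert–Samuel objects** (`Scheme.hsFun`, `Scheme.hsValues`,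
`Scheme.hsMaxLocus`, CJS Def. 2.28 / 2.35): a definitional unfolding of the route decl's inline
`H`. [cite: CossartJannsenSaito2020, Def. 2.28, Def. 2.35, Def. 6.15] -/
theorem sigmaMaxModifications_iff_hsFun :
    SigmaMaxModifications ↔
      ∀ p : ℕ, p.Prime → ∀ (k : Type) [Field k] [CharP k p] (X : Scheme.{0})
        (f : X ⟶ Spec (.of k)), IsSeparated f → LocallyOfFiniteType f → QuasiCompact f →
        IsReduced X → ¬ Scheme.IsRegular X →
        ∀ N : ℕ, topologicalKrullDim X ≤ (N : WithBot ℕ∞) →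
          ∃ (X' : Scheme.{0}) (π : X' ⟶ X), IsProper π ∧ IsReduced X' ∧
            topologicalKrullDim X' ≤ (N : WithBot ℕ∞) ∧
            (∀ U : X.Opens, (U : Set X) ⊆ (Scheme.hsMaxLocus X N)ᶜ → IsIso (π ∣_ U)) ∧
            Dense ((fun x' => π.base x') ⁻¹' (Scheme.hsMaxLocus X N)ᶜ) ∧
            (∀ x' : X', Scheme.hsFun X' N x' ≤ Scheme.hsFun X N (π.base x')) ∧
            ∀ ν : ℕ → ℕ, Maximal (· ∈ Scheme.hsValues X N) ν → ν ∉ Scheme.hsValues X' N :=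
  Iff.rfl

/-! ## Junk witnesses: (ME1) alone excludes `∅`, (ME2) alone excludes `𝟙` -/

/-- `dim ∅ = ⊥`. [folklore] -/
theorem topologicalKrullDim_empty : topologicalKrullDim (∅ : Scheme.{0}) = ⊥ := by
  haveI : IsEmpty (IrreducibleCloseds (∅ : Scheme.{0})) :=
    ⟨fun Z => Z.isIrreducible.nonempty.elim fun x _ => isEmptyElim x⟩
  exact Order.krullDim_eq_bot

/-- `∅` is reduced. [folklore] -/
theorem isReduced_empty : IsReduced (∅ : Scheme.{0}) :=
  ⟨fun _ => ⟨fun x _ => Subsingleton.elim x 0⟩⟩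

/-- **The EMPTY scheme satisfies every clause of the crux except (ME1)**, for every `X` and every
`N`: `∅ → X` is proper, `∅` is reduced of dimension `⊥`, every preimage is dense in `∅`,
monotonicity is vacuous and no function is a value on `∅` (so (ME2) holds). [folklore] -/
theorem emptyWitness_clauses (N : ℕ) (X : Scheme.{0}) :
    IsProper (Scheme.emptyTo X) ∧ IsReduced (∅ : Scheme.{0}) ∧
      topologicalKrullDim (∅ : Scheme.{0}) ≤ (N : WithBot ℕ∞) ∧
      Dense ((fun x' => (Scheme.emptyTo X).base x') ⁻¹' (Scheme.hsMaxLocus X N)ᶜ) ∧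
      (∀ x' : (∅ : Scheme.{0}),
        Scheme.hsFun _ N x' ≤ Scheme.hsFun X N ((Scheme.emptyTo X).base x')) ∧
      ∀ ν : ℕ → ℕ, Maximal (· ∈ Scheme.hsValues X N) ν → ν ∉ Scheme.hsValues (∅ : Scheme.{0}) N := by
  refine ⟨inferInstance, isReduced_empty, by rw [topologicalKrullDim_empty]; exact bot_le,
    fun x => isEmptyElim x, fun x => isEmptyElim x, ?_⟩
  rintro ν - ⟨x, -⟩
  exact isEmptyElim x

/-- **Without (ME1) the crux is TRIVIALLY TRUE** — the empty scheme witnesses it for every `X`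
and `N`, no hypothesis used: any proof must build `X'` out of (ME1), any disproof must use
(ME1). [folklore] -/
theorem withoutME1_trivial (X : Scheme.{0}) (N : ℕ) :
    ∃ (X' : Scheme.{0}) (π : X' ⟶ X), IsProper π ∧ IsReduced X' ∧
      topologicalKrullDim X' ≤ (N : WithBot ℕ∞) ∧
      Dense ((fun x' => π.base x') ⁻¹' (Scheme.hsMaxLocus X N)ᶜ) ∧
      (∀ x' : X', Scheme.hsFun X' N x' ≤ Scheme.hsFun X N (π.base x')) ∧
      ∀ ν : ℕ → ℕ, Maximal (· ∈ Scheme.hsValues X N) ν → ν ∉ Scheme.hsValues X' N :=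
  ⟨∅, Scheme.emptyTo X, emptyWitness_clauses N X⟩

/-- **(ME1) fails for `∅` over every non-empty open** (an isomorphism onto `U` is surjective).
For a reduced non-regular finite-type `X` the regular locus is a non-empty open inside
`X ∖ X_max` (CJS Lemma 2.31: regular points carry the minimal value `Φ^{(N)}`), which is what
kills `∅` in the crux itself. [cite: CossartJannsenSaito2020, Lemma 2.31] -/
theorem not_isIso_emptyTo_restrict {X : Scheme.{0}} (U : X.Opens) (hU : (U : Set X).Nonempty) :
    ¬ IsIso (Scheme.emptyTo X ∣_ U) := by
  intro h
  obtain ⟨x, hx⟩ := hU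
  obtain ⟨y, -⟩ := (inferInstance : Surjective (Scheme.emptyTo X ∣_ U)).1 ⟨x, hx⟩
  exact isEmptyElim (show (∅ : Scheme.{0}) from ((Scheme.emptyTo X) ⁻¹ᵁ U).ι.base y)

/-- **The IDENTITY satisfies every clause except (ME2)**, given the crux's `IsReduced X`,
`dim X ≤ N` and the density of `X ∖ X_max` (route support item `MaxLocusNowhereDense`,
CJS Rem. 6.13 (b)–(c)). [cite: CossartJannsenSaito2020, Rem. 6.13] -/
theorem identityWitness_clauses (N : ℕ) (X : Scheme.{0}) [IsReduced X]
    (hdim : topologicalKrullDim X ≤ (N : WithBot ℕ∞)) (hdense : Dense (Scheme.hsMaxLocus X N)ᶜ) :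
    IsProper (𝟙 X) ∧ IsReduced X ∧ topologicalKrullDim X ≤ (N : WithBot ℕ∞) ∧
      (∀ U : X.Opens, (U : Set X) ⊆ (Scheme.hsMaxLocus X N)ᶜ → IsIso (𝟙 X ∣_ U)) ∧
      Dense ((fun x' => (𝟙 X : X ⟶ X).base x') ⁻¹' (Scheme.hsMaxLocus X N)ᶜ) ∧
      ∀ x' : X, Scheme.hsFun X N x' ≤ Scheme.hsFun X N ((𝟙 X : X ⟶ X).base x') :=
  ⟨inferInstance, inferInstance, hdim, fun _ _ => inferInstance, hdense, fun _ => le_rfl⟩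

/-- **Without (ME2) the crux reduces to `Dense (X ∖ X_max)`** (identity witness).
[cite: CossartJannsenSaito2020, Rem. 6.13] -/
theorem withoutME2_of_dense (N : ℕ) (X : Scheme.{0}) [IsReduced X]
    (hdim : topologicalKrullDim X ≤ (N : WithBot ℕ∞)) (hdense : Dense (Scheme.hsMaxLocus X N)ᶜ) :
    ∃ (X' : Scheme.{0}) (π : X' ⟶ X), IsProper π ∧ IsReduced X' ∧
      topologicalKrullDim X' ≤ (N : WithBot ℕ∞) ∧
      (∀ U : X.Opens, (U : Set X) ⊆ (Scheme.hsMaxLocus X N)ᶜ → IsIso (π ∣_ U)) ∧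
      Dense ((fun x' => π.base x') ⁻¹' (Scheme.hsMaxLocus X N)ᶜ) ∧
      ∀ x' : X', Scheme.hsFun X' N x' ≤ Scheme.hsFun X N (π.base x') :=
  ⟨X, 𝟙 X, identityWitness_clauses N X hdim hdense⟩

/-- **(ME2) for the identity holds iff `X_max = ∅`** (a maximal value is a value); for a reduced
non-regular finite-type `X`, `Σ_X` is finite and non-empty (CJS Lemma 2.36 (b)), so the
identity is never a witness. [cite: CossartJannsenSaito2020, Lemma 2.36] -/
theorem ME2_self_iff (N : ℕ) (X : Scheme.{0}) :
    (∀ ν : ℕ → ℕ, Maximal (· ∈ Scheme.hsValues X N) ν → ν ∉ Scheme.hsValues X N) ↔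
      Scheme.hsMaxLocus X N = ∅ := by
  constructor
  · intro h
    ext x
    simp only [Scheme.mem_hsMaxLocus_iff, Set.mem_empty_iff_false, iff_false]
    exact fun hx => h _ hx hx.1
  · rintro h ν hν ⟨x, hx⟩
    have hmem : x ∈ Scheme.hsMaxLocus X N := by
      rw [Scheme.mem_hsMaxLocus_iff]
      show Maximal (· ∈ Scheme.hsValues X N) (Scheme.hsFun X N x)
      rw [hx]; exact hν
    rw [h] at hmem
    exact hmem

/-! ## (ME2) is "no near point survives"; (ME1)-opens are untouched -/

/-- **(ME2) ⟺ strict drop over `X_max`**: given the monotonicity clause, "no maximal value of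
`H_X` is a value of `H_{X'}`" holds iff `H^N_{X'}(x') < H^N_X(π x')` at every `x'` over `X_max`
(a maximal `ν' ≤ ν` with `ν` a value forces `ν = ν'`; CJS, remark after Def. 6.15).
[cite: CossartJannsenSaito2020, Def. 6.15] -/
theorem ME2_iff_forall_lt {N : ℕ} {X X' : Scheme.{0}} (π : X' ⟶ X)
    (hmono : ∀ x' : X', Scheme.hsFun X' N x' ≤ Scheme.hsFun X N (π.base x')) :
    (∀ ν : ℕ → ℕ, Maximal (· ∈ Scheme.hsValues X N) ν → ν ∉ Scheme.hsValues X' N) ↔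
      ∀ x' : X', π.base x' ∈ Scheme.hsMaxLocus X N →
        Scheme.hsFun X' N x' < Scheme.hsFun X N (π.base x') := by
  constructor
  · intro h x' hx'
    refine lt_of_le_of_ne (hmono x') fun heq => ?_
    exact h _ (by rw [Scheme.mem_hsMaxLocus_iff] at hx'; rw [← heq] at hx'; exact hx') ⟨x', rfl⟩
  · rintro h ν hν ⟨x', rfl⟩
    have hle := hmono x'
    have hge : Scheme.hsFun X N (π.base x') ≤ Scheme.hsFun X' N x' := hν.2 ⟨π.base x', rfl⟩ hle
    have heq : Scheme.hsFun X' N x' = Scheme.hsFun X N (π.base x') := le_antisymm hle hge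
    have hmax : π.base x' ∈ Scheme.hsMaxLocus X N := by
      rw [Scheme.mem_hsMaxLocus_iff, ← heq]; exact hν
    exact (h x' hmax).ne heq

/-- **Over an (ME1)-open nothing changes**: if `π ∣_ U` is an isomorphism then
`H^N_{X'}(x') = H^N_X(π x')` for every `x'` over `U` (the Hilbert–Samuel function depends only on
the local ring, tree `Scheme.hsFun_eq_of_isOpenImmersion`). So the monotonicity clause is
automatic there and "strict drop at EVERY point of `X'`" is an absurd strengthening.
[cite: CossartJannsenSaito2020, Def. 2.28] -/
theorem hsFun_eq_of_isIso_restrict {N : ℕ} {X X' : Scheme.{0}} [IsLocallyNoetherian X]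
    [IsLocallyNoetherian X'] (π : X' ⟶ X) (U : X.Opens) [IsIso (π ∣_ U)] (x' : X')
    (hx' : π.base x' ∈ U) : Scheme.hsFun X' N x' = Scheme.hsFun X N (π.base x') := by
  have hfac : (π ⁻¹ᵁ U).ι ≫ π = (π ∣_ U) ≫ U.ι := (morphismRestrict_ι π U).symm
  let y : ↥(π ⁻¹ᵁ U) := ⟨x', hx'⟩
  have hy : (π ⁻¹ᵁ U).ι.base y = x' := rfl
  have h1 : Scheme.hsFun (↑(π ⁻¹ᵁ U)) N y = Scheme.hsFun X N (((π ∣_ U) ≫ U.ι).base y) :=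
    Scheme.hsFun_eq_of_isOpenImmersion ((π ∣_ U) ≫ U.ι) N y
  have h2 : Scheme.hsFun (↑(π ⁻¹ᵁ U)) N y = Scheme.hsFun X' N ((π ⁻¹ᵁ U).ι.base y) :=
    Scheme.hsFun_eq_of_isOpenImmersion (π ⁻¹ᵁ U).ι N y
  rw [← hy, ← h2, h1, ← Scheme.Hom.comp_apply, ← hfac, Scheme.Hom.comp_apply]

/-! ## Load-bearing hypotheses (through (ME1)) -/

/-- **(ME1) + `IsReduced X'` ⟹ the (ME1)-opens of `X` are reduced.** Hence `IsReduced X` is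
LOAD-BEARING in the crux: with it dropped (and `IsReduced X'` kept) the statement fails at any
`X` with a non-reduced open inside `X ∖ X_max` — e.g. `Spec 𝔽_p[ε]/(ε²) ⊔ Spec 𝔽_p[ε]/(ε³)`
(values `(1,1,0,…)^{(N)} < (1,1,1,0,…)^{(N)}`: the first point is a non-reduced clopen inside
`X ∖ X_max`), cf. CJS Rem. 6.13 (d). [cite: CossartJannsenSaito2020, Rem. 6.13 (d)] -/
theorem isReduced_opens_of_isIso_restrict {X X' : Scheme.{0}} (π : X' ⟶ X) [IsReduced X']
    (U : X.Opens) [IsIso (π ∣_ U)] : IsReduced (U : Scheme.{0}) := by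
  haveI : IsReduced (↑(π ⁻¹ᵁ U) : Scheme.{0}) := isReduced_of_isOpenImmersion (π ⁻¹ᵁ U).ι
  exact isReduced_of_isOpenImmersion (inv (π ∣_ U))

/-- **(ME1) + `dim X' ≤ N` ⟹ the (ME1)-opens of `X` have dimension `≤ N`.** Hence `dim X ≤ N`
is LOAD-BEARING in the crux: with it dropped, at `N = 0` (where the truncated subtraction
`N - ψ` makes `H^0 = H^{(0)}` everywhere) any reduced singular curve, e.g. the node
`Spec 𝔽_p[x,y]/(xy)` with its one-dimensional open `D(x) ⊆ X ∖ X_max`, has no witness.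
[folklore] -/
theorem topologicalKrullDim_opens_le_of_isIso_restrict {N : ℕ} {X X' : Scheme.{0}} (π : X' ⟶ X)
    (hdim : topologicalKrullDim X' ≤ (N : WithBot ℕ∞)) (U : X.Opens) [IsIso (π ∣_ U)] :
    topologicalKrullDim (U : Scheme.{0}) ≤ (N : WithBot ℕ∞) := by
  have h1 : topologicalKrullDim (↑(π ⁻¹ᵁ U) : Scheme.{0}) ≤ topologicalKrullDim X' :=
    (π ⁻¹ᵁ U).ι.isOpenEmbedding.isEmbedding.isInducing.topologicalKrullDim_le
  have h2 : topologicalKrullDim (↑(π ⁻¹ᵁ U) : Scheme.{0}) = topologicalKrullDim (U : Scheme.{0}) :=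
    IsHomeomorph.topologicalKrullDim_eq _ (Scheme.homeoOfIso (asIso (π ∣_ U))).isHomeomorph
  rw [← h2]
  exact h1.trans hdim

/-- `dim 𝒪_{X,x} ≤ dim X` (`dim 𝒪_{X,x}` is the coheight of `x` in the specialisation order).
[cite: StacksProject, Tag 02IZ] -/
theorem ringKrullDim_stalk_le (X : Scheme.{0}) (x : X) :
    ringKrullDim (X.presheaf.stalk x) ≤ topologicalKrullDim X := by
  rw [AlgebraicGeometry.ringKrullDim_stalk_eq_coheight, topologicalKrullDim,
    Order.krullDim_eq_of_orderIso (irreducibleSetEquivPoints (α := X))]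
  exact Order.coheight_le_krullDim x

/-- **On a REGULAR scheme of dimension `≤ N` every point is in `X_max`** (all values are
`Φ^{(N)}`, CJS Rem. 2.32), i.e. `X ∖ X_max = ∅`. [cite: CossartJannsenSaito2020, Rem. 2.32] -/
theorem hsMaxLocus_eq_univ_of_isRegular {N : ℕ} {X : Scheme.{0}} (hreg : Scheme.IsRegular X)
    (hdim : topologicalKrullDim X ≤ (N : WithBot ℕ∞)) : Scheme.hsMaxLocus X N = Set.univ := by
  have hd : ∀ x : X, ∃ d : ℕ, ringKrullDim (X.presheaf.stalk x) = d ∧ d ≤ N := by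
    intro x
    haveI : IsRegularLocalRing (X.presheaf.stalk x) := hreg x
    have hle : ringKrullDim (X.presheaf.stalk x) ≤ (N : WithBot ℕ∞) :=
      (ringKrullDim_stalk_le X x).trans hdim
    obtain ⟨d, hd⟩ := exists_nat_eq_of_ne_bot_of_ne_top
      (ne_bot_of_le_ne_bot WithBot.zero_ne_bot ringKrullDim_nonneg_of_nontrivial)
      (ringKrullDim_ne_top (R := X.presheaf.stalk x))
    refine ⟨d, hd, ?_⟩
    rw [hd] at hle
    exact_mod_cast hle
  have hsub := Scheme.hsValues_subset_of_isRegular hreg hd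
  ext x
  simp only [Set.mem_univ, iff_true, Scheme.mem_hsMaxLocus_iff]
  refine ⟨⟨x, rfl⟩, fun μ hμ _ => ?_⟩
  rw [show μ = iterPSum N Phi from hsub hμ, show Scheme.hsFun X N x = iterPSum N Phi from hsub ⟨x, rfl⟩]

/-- **For a regular `X` of dimension `≤ N` the EMPTY scheme is a witness of the crux's
conclusion** ((ME1) is vacuous since `X ∖ X_max = ∅`). [folklore] -/
theorem exists_witness_of_isRegular {N : ℕ} {X : Scheme.{0}} (hreg : Scheme.IsRegular X)
    (hdim : topologicalKrullDim X ≤ (N : WithBot ℕ∞)) :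
    ∃ (X' : Scheme.{0}) (π : X' ⟶ X), IsProper π ∧ IsReduced X' ∧
      topologicalKrullDim X' ≤ (N : WithBot ℕ∞) ∧
      (∀ U : X.Opens, (U : Set X) ⊆ (Scheme.hsMaxLocus X N)ᶜ → IsIso (π ∣_ U)) ∧
      Dense ((fun x' => π.base x') ⁻¹' (Scheme.hsMaxLocus X N)ᶜ) ∧
      (∀ x' : X', Scheme.hsFun X' N x' ≤ Scheme.hsFun X N (π.base x')) ∧
      ∀ ν : ℕ → ℕ, Maximal (· ∈ Scheme.hsValues X N) ν → ν ∉ Scheme.hsValues X' N := by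
  obtain ⟨h1, h2, h3, h5, h6, h7⟩ := emptyWitness_clauses N X
  refine ⟨∅, Scheme.emptyTo X, h1, h2, h3, fun U hU => ?_, h5, h6, h7⟩
  rw [hsMaxLocus_eq_univ_of_isRegular hreg hdim, Set.compl_univ] at hU
  haveI : IsEmpty (U : Scheme.{0}) := ⟨fun u => hU u.2⟩
  infer_instance

/-- **`¬ IsRegular X` is REDUNDANT**: the crux implies the same statement with that hypothesis
deleted (regular `X` are served by the empty witness), so the two are equivalent and no proof
can draw anything from non-regularity beyond `X_max ≠ X`. [folklore] -/
theorem withoutNotIsRegular_of_sigmaMaxModifications (h : SigmaMaxModifications) :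
    ∀ p : ℕ, p.Prime → ∀ (k : Type) [Field k] [CharP k p] (X : Scheme.{0})
      (f : X ⟶ Spec (.of k)), IsSeparated f → LocallyOfFiniteType f → QuasiCompact f →
      IsReduced X → ∀ N : ℕ, topologicalKrullDim X ≤ (N : WithBot ℕ∞) →
        ∃ (X' : Scheme.{0}) (π : X' ⟶ X), IsProper π ∧ IsReduced X' ∧
          topologicalKrullDim X' ≤ (N : WithBot ℕ∞) ∧
          (∀ U : X.Opens, (U : Set X) ⊆ (Scheme.hsMaxLocus X N)ᶜ → IsIso (π ∣_ U)) ∧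
          Dense ((fun x' => π.base x') ⁻¹' (Scheme.hsMaxLocus X N)ᶜ) ∧
          (∀ x' : X', Scheme.hsFun X' N x' ≤ Scheme.hsFun X N (π.base x')) ∧
          ∀ ν : ℕ → ℕ, Maximal (· ∈ Scheme.hsValues X N) ν → ν ∉ Scheme.hsValues X' N := by
  intro p hp k _ _ X f hs hl hq hr N hN
  by_cases hreg : Scheme.IsRegular X
  · exact exists_witness_of_isRegular hreg hN
  · exact sigmaMaxModifications_iff_hsFun.mp h p hp k X f hs hl hq hr hreg N hN

end Summit.ResolutionOfSingularities.ResolutionOfSingularities.Theorems.SigmaMaxModifications.Negative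

end
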